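import Literature.Analysis.FluidPDE.StretchedLayerStripCalculus
import Literature.Analysis.FluidPDE.StretchedLayerShiftCalculus
import Literature.Analysis.FluidPDE.StretchedLayerEnergyClass
import HarnessLib

/-!
# The shift difference of a solution of the stretched layer system

Analysis/FluidPDE support file (everything proved, no definitions, no named facts). For a
classical solution `(u, v, p)` of the stretched two-dimensional Navier–Stokes layer system
(`IsStretchedLayerNSSolutionOn (Ioi 0) ν γ ΔU L u v p` of `StretchedLayerNS`) and a shift `ℓ`,
the `x`-translate `(u, v, p)(t, x + ℓ, y)` is again a solution (translation invariance), so the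
**shift difference** at a fixed time `t > 0`,

  `a = u(t, ·+ℓ, ·) − u(t, ·, ·)`, `b = v(t, ·+ℓ, ·) − v(t, ·, ·)`, `q = p(t, ·+ℓ, ·) − p(t, ·, ·)`,

satisfies the linearised system of `StretchedLayerStripEnergy` with transporting field
`(U, V) = (u, v)(t, ·+ℓ, ·)`, strain field `(u, v)(t)` and time-derivative fields
`a' = ∂ₜu(t, ·+ℓ, ·) − ∂ₜu(t, ·, ·)`, `b'` likewise. This file verifies that, under the
energy-class bounds at time `t` (bounded `u, v, ∂_y(u,v)`; `|∂ₓ(u,v)| ≤ Ce^{−k|y|}`; bounded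
`∂ₜ(u,v)` and pure second slice derivatives), all the `StripEnergyHypotheses` hold
(`IsStretchedLayerNSSolutionOn.stripEnergyHypotheses_shift`):

* `a, b` decay like `Cℓ e^{−k|y|}` (fundamental theorem of calculus in `x`:
  `a = ∫ₓ^{x+ℓ} ∂ₓu`, `StretchedLayer.abs_sub_shift_le`), `∂ₓa, ∂ₓb` like `2C e^{−k|y|}`;
* the pressure gradient, read off the momentum equations, grows at most linearly in `y`
  (`abs_dX_p_le_of_bounds`, `abs_dY_p_le_of_bounds`: the only unbounded coefficient is the strain
  drift `γy ∂_y`), so `q` grows at most quadratically (mean value along `y`, and a bound on the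
  period line `y = 0` by continuity and periodicity).

All statements are folklore; the computation `translate − original` is the one behind
Majda–Bertozzi 2002, §3.1.1 (difference of two solutions), specialised to a solution and its own
translate.
-/

noncomputable section

open Set Function Filter
open _root_.MeasureTheory
open scoped Topology

namespace Literature.Analysis.FluidPDE

open StretchedLayer

/-- Products of bounded factors: `|g₁| ≤ M₁`, `|g₂| ≤ M₂` give `|g₁ g₂| ≤ M₁ M₂` (private copy;
a public version is `Literature.Analysis.FluidPDE.CompressibleEuler.abs_mul_le_of_le`, not in this
import closure). [folklore] -/
private theorem abs_mul_le_mul_of_abs_le {g₁ g₂ M₁ M₂ : ℝ} (h₁ : |g₁| ≤ M₁) (h₂ : |g₂| ≤ M₂) :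
    |g₁ * g₂| ≤ M₁ * M₂ := by
  rw [abs_mul]
  exact mul_le_mul h₁ h₂ (abs_nonneg _) ((abs_nonneg _).trans h₁)

/-! ### The pressure gradient read off the momentum equations -/

variable {ν γ ΔU L : ℝ} {u v p : ℝ → ℝ → ℝ → ℝ}

/-- **`∂ₓp` grows at most linearly across the layer**: for a solution on `(0, ∞)` with, at time
`t > 0`, `|u| + |v| + |∂_yu| + |∂_yv| ≤ C`, `|∂ₓu| + |∂ₓv| ≤ C` and
`|∂ₜu| + |∂ₜv| + |∂ₓ∂ₓu| + |∂_y∂_yu| + |∂ₓ∂ₓv| + |∂_y∂_yv| ≤ C'`, the `x`-momentum equation gives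
`|∂ₓp| ≤ (C' + 2C² + 2|ν|C' + 2|γ|C)(1 + |y|)`. [folklore] -/
theorem IsStretchedLayerNSSolutionOn.abs_dX_p_le_of_bounds
    (h : IsStretchedLayerNSSolutionOn (Ioi 0) ν γ ΔU L u v p) {t C C' : ℝ} (ht : 0 < t)
    (hb1 : ∀ x y, |u t x y| + |v t x y| + |dY (u t) x y| + |dY (v t) x y| ≤ C)
    (hb2 : ∀ x y, |dX (u t) x y| + |dX (v t) x y| ≤ C)
    (hb3 : ∀ x y, |deriv (fun s => u s x y) t| + |deriv (fun s => v s x y) t| +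
      |dX (dX (u t)) x y| + |dY (dY (u t)) x y| + |dX (dX (v t)) x y| + |dY (dY (v t)) x y| ≤ C')
    (x y : ℝ) :
    |dX (p t) x y| ≤ (C' + 2 * C * C + 2 * |ν| * C' + 2 * |γ| * C) * (1 + |y|) := by
  have hm := h.momentum_x t ht x y
  rw [dT_of_isOpen isOpen_Ioi u ht] at hm
  have e : dX (p t) x y = -(deriv (fun s => u s x y) t) - u t x y * dX (u t) x y -
      (v t x y - γ * y) * dY (u t) x y + ν * (dX (dX (u t)) x y + dY (dY (u t)) x y) := by
    rw [lap_apply] at hm; linarith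
  have h1 := hb1 x y
  have h2 := hb2 x y
  have h3 := hb3 x y
  have hC : 0 ≤ C := le_trans (by positivity) h2
  have hut : |deriv (fun s => u s x y) t| ≤ C' := by
    linarith [abs_nonneg (deriv (fun s => v s x y) t), abs_nonneg (dX (dX (u t)) x y),
      abs_nonneg (dY (dY (u t)) x y), abs_nonneg (dX (dX (v t)) x y),
      abs_nonneg (dY (dY (v t)) x y)]
  have hu : |u t x y| ≤ C := by
    linarith [abs_nonneg (v t x y), abs_nonneg (dY (u t) x y), abs_nonneg (dY (v t) x y)]
  have hv : |v t x y| ≤ C := by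
    linarith [abs_nonneg (u t x y), abs_nonneg (dY (u t) x y), abs_nonneg (dY (v t) x y)]
  have huy : |dY (u t) x y| ≤ C := by
    linarith [abs_nonneg (u t x y), abs_nonneg (v t x y), abs_nonneg (dY (v t) x y)]
  have hux : |dX (u t) x y| ≤ C := by linarith [abs_nonneg (dX (v t) x y)]
  have huxx : |dX (dX (u t)) x y| ≤ C' := by
    linarith [abs_nonneg (deriv (fun s => u s x y) t), abs_nonneg (deriv (fun s => v s x y) t),
      abs_nonneg (dY (dY (u t)) x y), abs_nonneg (dX (dX (v t)) x y),
      abs_nonneg (dY (dY (v t)) x y)]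
  have huyy : |dY (dY (u t)) x y| ≤ C' := by
    linarith [abs_nonneg (deriv (fun s => u s x y) t), abs_nonneg (deriv (fun s => v s x y) t),
      abs_nonneg (dX (dX (u t)) x y), abs_nonneg (dX (dX (v t)) x y),
      abs_nonneg (dY (dY (v t)) x y)]
  rw [e]
  have i1 : |u t x y * dX (u t) x y| ≤ C * C := abs_mul_le_mul_of_abs_le hu hux
  have i2 : |(v t x y - γ * y) * dY (u t) x y| ≤ (C + |γ|) * (1 + |y|) * C :=
    abs_mul_le_mul_of_abs_le (abs_sub_mul_le_linear y hC hv) huy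
  have i3 : |ν * (dX (dX (u t)) x y + dY (dY (u t)) x y)| ≤ |ν| * (C' + C') := by
    rw [abs_mul]
    exact mul_le_mul_of_nonneg_left ((abs_add_le _ _).trans (add_le_add huxx huyy)) (abs_nonneg ν)
  have hy0 : 0 ≤ |y| := abs_nonneg y
  have hC'0 : 0 ≤ C' := (abs_nonneg _).trans hut
  calc _ ≤ |-(deriv (fun s => u s x y) t) - u t x y * dX (u t) x y -
        (v t x y - γ * y) * dY (u t) x y| + |ν * (dX (dX (u t)) x y + dY (dY (u t)) x y)| :=
        abs_add_le _ _
    _ ≤ (|-(deriv (fun s => u s x y) t) - u t x y * dX (u t) x y| +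
        |(v t x y - γ * y) * dY (u t) x y|) + |ν * (dX (dX (u t)) x y + dY (dY (u t)) x y)| := by
        gcongr; exact abs_sub _ _
    _ ≤ ((|-(deriv (fun s => u s x y) t)| + |u t x y * dX (u t) x y|) +
        |(v t x y - γ * y) * dY (u t) x y|) + |ν * (dX (dX (u t)) x y + dY (dY (u t)) x y)| := by
        gcongr; exact abs_sub _ _
    _ ≤ ((C' + C * C) + (C + |γ|) * (1 + |y|) * C) + |ν| * (C' + C') := by
        rw [abs_neg]; gcongr
    _ ≤ (C' + 2 * C * C + 2 * |ν| * C' + 2 * |γ| * C) * (1 + |y|) := by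
        nlinarith [abs_nonneg ν, abs_nonneg γ, mul_nonneg (abs_nonneg γ) hC,
          mul_nonneg (abs_nonneg ν) hC'0, mul_nonneg hC hC]

/-- **`∂_yp` grows at most linearly across the layer** (the `y`-momentum equation; same bounds
as `abs_dX_p_le_of_bounds`). [folklore] -/
theorem IsStretchedLayerNSSolutionOn.abs_dY_p_le_of_bounds
    (h : IsStretchedLayerNSSolutionOn (Ioi 0) ν γ ΔU L u v p) {t C C' : ℝ} (ht : 0 < t)
    (hb1 : ∀ x y, |u t x y| + |v t x y| + |dY (u t) x y| + |dY (v t) x y| ≤ C)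
    (hb2 : ∀ x y, |dX (u t) x y| + |dX (v t) x y| ≤ C)
    (hb3 : ∀ x y, |deriv (fun s => u s x y) t| + |deriv (fun s => v s x y) t| +
      |dX (dX (u t)) x y| + |dY (dY (u t)) x y| + |dX (dX (v t)) x y| + |dY (dY (v t)) x y| ≤ C')
    (x y : ℝ) :
    |dY (p t) x y| ≤ (C' + 2 * C * C + 2 * |ν| * C' + 2 * |γ| * C) * (1 + |y|) := by
  have hm := h.momentum_y t ht x y
  rw [dT_of_isOpen isOpen_Ioi v ht] at hm
  have e : dY (p t) x y = -(deriv (fun s => v s x y) t) - u t x y * dX (v t) x y -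
      (v t x y - γ * y) * dY (v t) x y + γ * v t x y +
      ν * (dX (dX (v t)) x y + dY (dY (v t)) x y) := by
    rw [lap_apply] at hm; linarith
  have h1 := hb1 x y
  have h2 := hb2 x y
  have h3 := hb3 x y
  have hC : 0 ≤ C := le_trans (by positivity) h2
  have hvt : |deriv (fun s => v s x y) t| ≤ C' := by
    linarith [abs_nonneg (deriv (fun s => u s x y) t), abs_nonneg (dX (dX (u t)) x y),
      abs_nonneg (dY (dY (u t)) x y), abs_nonneg (dX (dX (v t)) x y),
      abs_nonneg (dY (dY (v t)) x y)]
  have hu : |u t x y| ≤ C := by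
    linarith [abs_nonneg (v t x y), abs_nonneg (dY (u t) x y), abs_nonneg (dY (v t) x y)]
  have hv : |v t x y| ≤ C := by
    linarith [abs_nonneg (u t x y), abs_nonneg (dY (u t) x y), abs_nonneg (dY (v t) x y)]
  have hvy : |dY (v t) x y| ≤ C := by
    linarith [abs_nonneg (u t x y), abs_nonneg (v t x y), abs_nonneg (dY (u t) x y)]
  have hvx : |dX (v t) x y| ≤ C := by linarith [abs_nonneg (dX (u t) x y)]
  have hvxx : |dX (dX (v t)) x y| ≤ C' := by
    linarith [abs_nonneg (deriv (fun s => u s x y) t), abs_nonneg (deriv (fun s => v s x y) t),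
      abs_nonneg (dY (dY (u t)) x y), abs_nonneg (dX (dX (u t)) x y),
      abs_nonneg (dY (dY (v t)) x y)]
  have hvyy : |dY (dY (v t)) x y| ≤ C' := by
    linarith [abs_nonneg (deriv (fun s => u s x y) t), abs_nonneg (deriv (fun s => v s x y) t),
      abs_nonneg (dX (dX (u t)) x y), abs_nonneg (dX (dX (v t)) x y),
      abs_nonneg (dY (dY (u t)) x y)]
  rw [e]
  have i1 : |u t x y * dX (v t) x y| ≤ C * C := abs_mul_le_mul_of_abs_le hu hvx
  have i2 : |(v t x y - γ * y) * dY (v t) x y| ≤ (C + |γ|) * (1 + |y|) * C :=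
    abs_mul_le_mul_of_abs_le (abs_sub_mul_le_linear y hC hv) hvy
  have i3 : |ν * (dX (dX (v t)) x y + dY (dY (v t)) x y)| ≤ |ν| * (C' + C') := by
    rw [abs_mul]
    exact mul_le_mul_of_nonneg_left ((abs_add_le _ _).trans (add_le_add hvxx hvyy)) (abs_nonneg ν)
  have i4 : |γ * v t x y| ≤ |γ| * C := by
    rw [abs_mul]; exact mul_le_mul_of_nonneg_left hv (abs_nonneg γ)
  have hy0 : 0 ≤ |y| := abs_nonneg y
  have hC'0 : 0 ≤ C' := (abs_nonneg _).trans hvt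
  calc _ ≤ |-(deriv (fun s => v s x y) t) - u t x y * dX (v t) x y -
        (v t x y - γ * y) * dY (v t) x y + γ * v t x y| +
        |ν * (dX (dX (v t)) x y + dY (dY (v t)) x y)| := abs_add_le _ _
    _ ≤ (|-(deriv (fun s => v s x y) t) - u t x y * dX (v t) x y -
        (v t x y - γ * y) * dY (v t) x y| + |γ * v t x y|) +
        |ν * (dX (dX (v t)) x y + dY (dY (v t)) x y)| := by
        gcongr; exact abs_add_le _ _
    _ ≤ ((|-(deriv (fun s => v s x y) t) - u t x y * dX (v t) x y| +
        |(v t x y - γ * y) * dY (v t) x y|) + |γ * v t x y|) +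
        |ν * (dX (dX (v t)) x y + dY (dY (v t)) x y)| := by
        gcongr; exact abs_sub _ _
    _ ≤ (((|-(deriv (fun s => v s x y) t)| + |u t x y * dX (v t) x y|) +
        |(v t x y - γ * y) * dY (v t) x y|) + |γ * v t x y|) +
        |ν * (dX (dX (v t)) x y + dY (dY (v t)) x y)| := by
        gcongr; exact abs_sub _ _
    _ ≤ (((C' + C * C) + (C + |γ|) * (1 + |y|) * C) + |γ| * C) + |ν| * (C' + C') := by
        rw [abs_neg]; gcongr
    _ ≤ (C' + 2 * C * C + 2 * |ν| * C' + 2 * |γ| * C) * (1 + |y|) := by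
        nlinarith [abs_nonneg ν, abs_nonneg γ, mul_nonneg (abs_nonneg γ) hC,
          mul_nonneg (abs_nonneg ν) hC'0, mul_nonneg hC hC]

/-! ### The shift difference satisfies the hypotheses of the strip energy inequality -/

/-- **The shift difference of an energy-class solution is an admissible perturbation.** For a
solution of the stretched layer system on `(0, ∞)` with period `L > 0`, a shift `ℓ ≥ 0` and a
time `t > 0` at which the energy-class bounds hold (`|u| + |v| + |∂_yu| + |∂_yv| ≤ C`,
`|∂ₓu| + |∂ₓv| ≤ Ce^{−k|y|}`, `k > 0`, and `|∂ₜu| + |∂ₜv| + Σ|∂²(u,v)| ≤ C'`), the shift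
difference `(a, b, q) = (u, v, p)(t, ·+ℓ, ·) − (u, v, p)(t, ·, ·)`, transported by
`(u, v)(t, ·+ℓ, ·)`, strained by `∇(u, v)(t)`, with time-derivative fields
`∂ₜ(u,v)(t, ·+ℓ, ·) − ∂ₜ(u,v)(t, ·, ·)`, satisfies `StretchedLayer.StripEnergyHypotheses L γ ν`
(translation invariance of the system; decay `|a|, |b| ≤ Cℓe^{−k|y|}` by the mean value
inequality in `x`; pressure growth from the momentum equations). [folklore] -/
theorem IsStretchedLayerNSSolutionOn.stripEnergyHypotheses_shift
    (h : IsStretchedLayerNSSolutionOn (Ioi 0) ν γ ΔU L u v p) (hL : 0 < L) {ℓ t C C' k : ℝ}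
    (hℓ : 0 ≤ ℓ) (ht : 0 < t) (hk : 0 < k)
    (hb1 : ∀ x y, |u t x y| + |v t x y| + |dY (u t) x y| + |dY (v t) x y| ≤ C)
    (hb2 : ∀ x y, |dX (u t) x y| + |dX (v t) x y| ≤ C * Real.exp (-k * |y|))
    (hb3 : ∀ x y, |deriv (fun s => u s x y) t| + |deriv (fun s => v s x y) t| +
      |dX (dX (u t)) x y| + |dY (dY (u t)) x y| + |dX (dX (v t)) x y| + |dY (dY (v t)) x y| ≤ C') :
    StripEnergyHypotheses L γ ν (fun x y => u t (x + ℓ) y) (fun x y => v t (x + ℓ) y) (u t) (v t)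
      (fun x y => u t (x + ℓ) y - u t x y) (fun x y => v t (x + ℓ) y - v t x y)
      (fun x y => p t (x + ℓ) y - p t x y)
      (fun x y => deriv (fun s => u s (x + ℓ) y) t - deriv (fun s => u s x y) t)
      (fun x y => deriv (fun s => v s (x + ℓ) y) t - deriv (fun s => v s x y) t) := by
  have hu2 := h.contDiff_u ht
  have hv2 := h.contDiff_v ht
  have hp1 := h.contDiff_p ht
  have hu1 : ContDiff ℝ 1 (fun q : ℝ × ℝ => u t q.1 q.2) := hu2.of_le one_le_two
  have hv1 : ContDiff ℝ 1 (fun q : ℝ × ℝ => v t q.1 q.2) := hv2.of_le one_le_two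
  have he1 : ∀ y : ℝ, Real.exp (-k * |y|) ≤ 1 := fun y =>
    Real.exp_le_one_iff.2 (by nlinarith [abs_nonneg y, hk])
  -- atomic bounds at time `t`
  have hC0 : 0 ≤ C := le_trans (by positivity) (hb1 0 0)
  have hu : ∀ x y, |u t x y| ≤ C := fun x y => by
    linarith [hb1 x y, abs_nonneg (v t x y), abs_nonneg (dY (u t) x y), abs_nonneg (dY (v t) x y)]
  have hv : ∀ x y, |v t x y| ≤ C := fun x y => by
    linarith [hb1 x y, abs_nonneg (u t x y), abs_nonneg (dY (u t) x y), abs_nonneg (dY (v t) x y)]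
  have huy : ∀ x y, |dY (u t) x y| ≤ C := fun x y => by
    linarith [hb1 x y, abs_nonneg (u t x y), abs_nonneg (v t x y), abs_nonneg (dY (v t) x y)]
  have hvy : ∀ x y, |dY (v t) x y| ≤ C := fun x y => by
    linarith [hb1 x y, abs_nonneg (u t x y), abs_nonneg (v t x y), abs_nonneg (dY (u t) x y)]
  have hux : ∀ x y, |dX (u t) x y| ≤ C * Real.exp (-k * |y|) := fun x y => by
    linarith [hb2 x y, abs_nonneg (dX (v t) x y)]
  have hvx : ∀ x y, |dX (v t) x y| ≤ C * Real.exp (-k * |y|) := fun x y => by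
    linarith [hb2 x y, abs_nonneg (dX (u t) x y)]
  have hb2' : ∀ x y, |dX (u t) x y| + |dX (v t) x y| ≤ C := fun x y =>
    (hb2 x y).trans (mul_le_of_le_one_right hC0 (he1 y))
  have huxC : ∀ x y, |dX (u t) x y| ≤ C := fun x y =>
    (hux x y).trans (mul_le_of_le_one_right hC0 (he1 y))
  have huxx : ∀ x y, |dX (dX (u t)) x y| ≤ C' := fun x y => by
    linarith [hb3 x y, abs_nonneg (deriv (fun s => u s x y) t),
      abs_nonneg (deriv (fun s => v s x y) t), abs_nonneg (dY (dY (u t)) x y),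
      abs_nonneg (dX (dX (v t)) x y), abs_nonneg (dY (dY (v t)) x y)]
  have huyy : ∀ x y, |dY (dY (u t)) x y| ≤ C' := fun x y => by
    linarith [hb3 x y, abs_nonneg (deriv (fun s => u s x y) t),
      abs_nonneg (deriv (fun s => v s x y) t), abs_nonneg (dX (dX (u t)) x y),
      abs_nonneg (dX (dX (v t)) x y), abs_nonneg (dY (dY (v t)) x y)]
  have hvxx : ∀ x y, |dX (dX (v t)) x y| ≤ C' := fun x y => by
    linarith [hb3 x y, abs_nonneg (deriv (fun s => u s x y) t),
      abs_nonneg (deriv (fun s => v s x y) t), abs_nonneg (dY (dY (u t)) x y),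
      abs_nonneg (dX (dX (u t)) x y), abs_nonneg (dY (dY (v t)) x y)]
  have hvyy : ∀ x y, |dY (dY (v t)) x y| ≤ C' := fun x y => by
    linarith [hb3 x y, abs_nonneg (deriv (fun s => u s x y) t),
      abs_nonneg (deriv (fun s => v s x y) t), abs_nonneg (dX (dX (u t)) x y),
      abs_nonneg (dX (dX (v t)) x y), abs_nonneg (dY (dY (u t)) x y)]
  -- the pressure gradient and the growth of the shifted pressure difference
  set P : ℝ := C' + 2 * C * C + 2 * |ν| * C' + 2 * |γ| * C with hP_def
  have hpx : ∀ x y, |dX (p t) x y| ≤ P * (1 + |y|) := h.abs_dX_p_le_of_bounds ht hb1 hb2' hb3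
  have hpy : ∀ x y, |dY (p t) x y| ≤ P * (1 + |y|) := h.abs_dY_p_le_of_bounds ht hb1 hb2' hb3
  have hP0 : 0 ≤ P := by
    have h0 := (abs_nonneg _).trans (hpx 0 0)
    rw [abs_zero, add_zero, mul_one] at h0
    exact h0
  have hqx : ∀ x y, |dX (fun r s => p t (r + ℓ) s - p t r s) x y| ≤ 2 * P * (1 + |y|) :=
    fun x y => by
      rw [dX_shiftSub hp1 one_ne_zero]
      exact (abs_sub _ _).trans (by linarith [hpx (x + ℓ) y, hpx x y])
  have hqy : ∀ x y, |dY (fun r s => p t (r + ℓ) s - p t r s) x y| ≤ 2 * P * (1 + |y|) :=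
    fun x y => by
      rw [dY_shiftSub hp1 one_ne_zero]
      exact (abs_sub _ _).trans (by linarith [hpy (x + ℓ) y, hpy x y])
  have hq1 : ContDiff ℝ 1 (fun q : ℝ × ℝ => p t (q.1 + ℓ) q.2 - p t q.1 q.2) :=
    contDiff_shiftSub hp1 ℓ
  have hqper : ∀ x, p t (x + L + ℓ) 0 - p t (x + L) 0 = p t (x + ℓ) 0 - p t x 0 := fun x => by
    rw [add_right_comm x L ℓ, h.periodic_p t ht, h.periodic_p t ht]
  obtain ⟨M₀, hM₀⟩ := exists_abs_le_of_periodic (g := fun x => p t (x + ℓ) 0 - p t x 0) hL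
    (continuous_slice_x (f := fun r s => p t (r + ℓ) s - p t r s) hq1.continuous 0) hqper
  have hM₀0 : 0 ≤ M₀ := (abs_nonneg _).trans (hM₀ 0)
  have hq : ∀ x y, |p t (x + ℓ) y - p t x y| ≤ (M₀ + 2 * P) * (1 + |y|) ^ 2 := by
    intro x y
    have hmv := abs_sub_zero_le_of_abs_deriv_le (g := fun s => p t (x + ℓ) s - p t x s)
      (fun s => (hasDerivAt_dY_of_contDiff (f := fun r s => p t (r + ℓ) s - p t r s) hq1
        one_ne_zero x s).differentiableAt)
      (fun s => hqy x s) y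
    have h0 := hM₀ x
    have hy := abs_nonneg y
    calc |p t (x + ℓ) y - p t x y|
        ≤ |p t (x + ℓ) 0 - p t x 0| + |p t (x + ℓ) y - p t x y - (p t (x + ℓ) 0 - p t x 0)| := by
          have := abs_add_le (p t (x + ℓ) 0 - p t x 0)
            (p t (x + ℓ) y - p t x y - (p t (x + ℓ) 0 - p t x 0))
          rwa [add_sub_cancel] at this
      _ ≤ M₀ + 2 * P * (1 + |y|) * |y| := add_le_add h0 hmv
      _ ≤ (M₀ + 2 * P) * (1 + |y|) ^ 2 := by nlinarith [mul_nonneg hP0 hy, mul_nonneg hM₀0 hy]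
  -- the structure
  refine
    { contDiff_a := contDiff_shiftSub hu2 ℓ
      contDiff_b := contDiff_shiftSub hv2 ℓ
      contDiff_p := hq1
      contDiff_U := contDiff_translate hu1 ℓ
      contDiff_V := contDiff_translate hv1 ℓ
      contDiff_u := hu1
      contDiff_v := hv1
      eq_a := fun x y => ?_
      eq_b := fun x y => ?_
      divFree := fun x y => ?_
      divFree_UV := fun x y => ?_
      periodic_a := fun x y => ?_
      periodic_b := fun x y => ?_
      periodic_p := fun x y => ?_
      periodic_U := fun x y => ?_
      decay := ⟨k, C * ℓ + 2 * C, hk, by positivity, fun x y => ⟨?_, ?_, ?_, ?_⟩⟩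
      bounded_dY := ⟨2 * C, fun x y => ⟨?_, ?_⟩⟩
      bounded_dd := ⟨2 * C', fun x y => ⟨?_, ?_, ?_, ?_⟩⟩
      bounded_UV := ⟨C, fun x y => ⟨hu _ _, hv _ _, ?_, ?_⟩⟩
      pressure := ⟨M₀ + 2 * P, fun x y => ⟨hq x y, ?_, ?_⟩⟩ }
  · -- the linearised `x`-momentum equation = difference of the two momentum equations
    have e1 := h.momentum_x t ht (x + ℓ) y
    have e2 := h.momentum_x t ht x y
    rw [dT_of_isOpen isOpen_Ioi u ht] at e1 e2
    rw [dX_shiftSub hu2 two_ne_zero, dY_shiftSub hu2 two_ne_zero, dX_shiftSub hp1 one_ne_zero,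
      lap_shiftSub hu2]
    linear_combination e1 - e2
  · have e1 := h.momentum_y t ht (x + ℓ) y
    have e2 := h.momentum_y t ht x y
    rw [dT_of_isOpen isOpen_Ioi v ht] at e1 e2
    rw [dX_shiftSub hv2 two_ne_zero, dY_shiftSub hv2 two_ne_zero, dY_shiftSub hp1 one_ne_zero,
      lap_shiftSub hv2]
    linear_combination e1 - e2
  · rw [dX_shiftSub hu2 two_ne_zero, dY_shiftSub hv2 two_ne_zero]
    linear_combination h.divFree t ht (x + ℓ) y - h.divFree t ht x y
  · rw [dX_translate, dY_translate]
    exact h.divFree t ht (x + ℓ) y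
  · show u t (x + L + ℓ) y - u t (x + L) y = u t (x + ℓ) y - u t x y
    rw [add_right_comm x L ℓ, h.periodic_u t ht, h.periodic_u t ht]
  · show v t (x + L + ℓ) y - v t (x + L) y = v t (x + ℓ) y - v t x y
    rw [add_right_comm x L ℓ, h.periodic_v t ht, h.periodic_v t ht]
  · show p t (x + L + ℓ) y - p t (x + L) y = p t (x + ℓ) y - p t x y
    rw [add_right_comm x L ℓ, h.periodic_p t ht, h.periodic_p t ht]
  · show u t (x + L + ℓ) y = u t (x + ℓ) y
    rw [add_right_comm x L ℓ, h.periodic_u t ht]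
  · calc |u t (x + ℓ) y - u t x y| ≤ C * ℓ * Real.exp (-k * |y|) :=
          abs_shiftSub_le hu2 two_ne_zero hℓ hux x y
      _ ≤ (C * ℓ + 2 * C) * Real.exp (-k * |y|) := by
          nlinarith [Real.exp_pos (-k * |y|)]
  · calc |v t (x + ℓ) y - v t x y| ≤ C * ℓ * Real.exp (-k * |y|) :=
          abs_shiftSub_le hv2 two_ne_zero hℓ hvx x y
      _ ≤ (C * ℓ + 2 * C) * Real.exp (-k * |y|) := by
          nlinarith [Real.exp_pos (-k * |y|)]
  · rw [dX_shiftSub hu2 two_ne_zero]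
    refine (abs_sub _ _).trans ?_
    nlinarith [hux (x + ℓ) y, hux x y, mul_nonneg (mul_nonneg hC0 hℓ) (Real.exp_pos (-k * |y|)).le]
  · rw [dX_shiftSub hv2 two_ne_zero]
    refine (abs_sub _ _).trans ?_
    nlinarith [hvx (x + ℓ) y, hvx x y, mul_nonneg (mul_nonneg hC0 hℓ) (Real.exp_pos (-k * |y|)).le]
  · rw [dY_shiftSub hu2 two_ne_zero]
    exact (abs_sub _ _).trans (by linarith [huy (x + ℓ) y, huy x y])
  · rw [dY_shiftSub hv2 two_ne_zero]
    exact (abs_sub _ _).trans (by linarith [hvy (x + ℓ) y, hvy x y])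
  · rw [dXdX_shiftSub hu2]
    exact (abs_sub _ _).trans (by linarith [huxx (x + ℓ) y, huxx x y])
  · rw [dYdY_shiftSub hu2]
    exact (abs_sub _ _).trans (by linarith [huyy (x + ℓ) y, huyy x y])
  · rw [dXdX_shiftSub hv2]
    exact (abs_sub _ _).trans (by linarith [hvxx (x + ℓ) y, hvxx x y])
  · rw [dYdY_shiftSub hv2]
    exact (abs_sub _ _).trans (by linarith [hvyy (x + ℓ) y, hvyy x y])
  · rw [dX_translate]; exact huxC _ _
  · rw [dY_translate]; exact hvy _ _
  · exact (hqx x y).trans (by nlinarith [abs_nonneg y])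
  · exact (hqy x y).trans (by nlinarith [abs_nonneg y])

end Literature.Analysis.FluidPDE
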